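import Summits.CriticalPhenomena.CardyFormulaZ2.Theorems.CardyBoundaryCoulombGasHalfPlaneMarkDensityLawRigidityLemmas
import Summits.CriticalPhenomena.CardyFormulaZ2.Theorems.CardyBoundaryCoulombGasHalfPlaneMarkDensityLawRealMesh
import Summits.CriticalPhenomena.CardyFormulaZ2.Theorems.CardyBoundaryCoulombGasHalfPlaneMarkDensityLawMeshSandwich
import Summits.CriticalPhenomena.CardyFormulaZ2.Theorems.CardyBoundaryCoulombGasHalfPlaneMarkDensityLawBoxExhaustion

/-!
# Line `Sketch` — SUBSEQUENTIAL RIGIDITY: the collinear half-plane Cardy law pins every conformal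
# crossing limit along ANY mesh sequence (crux `HalfPlaneMarkDensityLaw`, stmt-CriticalPhenomena-5661)

THEOREM (`eqOn_cardyFunction_of_collinearCardy_subseq`).  Assume C⁺ (collinear half-plane Cardy for
bond-`ℤ²`, the one open stub of the line, `⟺` crux 5).  Let `u_k → 0⁺` be ANY sequence of meshes and
`g : ℝ → ℝ` a function such that, for every conformal rectangle `R` and every uniformizing datum
`(ψ, x)` of `R`, `bondDomainCrossingProb R (u_k) → g (crossRatio x)`.  Then `g = F` on `(0,1)`.

This is the hypothesis shape of the subsequential identification cruxes `CardyMirrorMonotone.SubseqRigidity`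
(stmt-CriticalPhenomena-8271), `CardyBlackNoise.SubseqCardyRigidity`, `CardyExpCovariance.CardyRigiditySeq`
— all rated "SLE₆ identification with an unknown kernel"; given ANY half-plane Cardy statement they are
elementary (file `…SubseqRigidityCorollaries`).

Proof: as in `…Rigidity` (box exhaustion run backwards on the Schwarz–Christoffel box `R_t` with the
scale-invariant prevertex tuple `t·p`, `crossRatio p = x₀`), but at a GENERAL mesh `δ = u_k`: the lattice
sandwich `bondDomainCrossingProb R_t δ ≤ P_δ ≤ bondDomainCrossingProb R_t δ + P[Λ_r ↔ Λ_Nᶜ]`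
(`stub_meshLower` / `stub_meshUpper`, continuum arcs `{t m₀(t) ≤ δ v₀ ≤ t m₁(t)}`, no floor slack),
the half-plane limit `P_δ → F(η(m(t)))` along real meshes (`RealMesh.tendsto_realMesh`, from C⁺), the
escape radii `r = ⌈3t/δ⌉`, `N = ⌊8κ/δ⌋` with `r/N ≤ 1/L` once `δ (L+1) ≤ 5κ` (`t = κ/L`), and
`F(η(m(κ/L))) → F x₀` as `L → ∞`.
-/

noncomputable section

namespace Summit.CriticalPhenomena.CardyFormulaZ2.Cruxes.HalfPlaneMarkDensityLaw.SketchLine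

open Set Metric MeasureTheory Filter
open Literature.Probability.LatticeModels
open Literature.Probability.Percolation hiding cardyFunction
open Literature.Probability.RandomPlanarGeometry
open UpperHalfPlane (upperHalfPlaneSet)
open Summit.CriticalPhenomena.CardyFormulaZ2.Theorems.HalfPlaneMarkDensityLaw.Negative
open scoped Topology

namespace SubseqRigidity

/-- `![t m₀, t m₁, t m₂, t m₃]` has the cross-ratio of `m` (`t ≠ 0`). [folklore] -/
theorem crossRatio_scale (m : Fin 4 → ℝ) {t : ℝ} (ht : t ≠ 0) :
    crossRatio ![t * m 0, t * m 1, t * m 2, t * m 3] = crossRatio m := by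
  have e : (![t * m 0, t * m 1, t * m 2, t * m 3] : Fin 4 → ℝ) = fun i ↦ t * m i + 0 := by
    funext i; fin_cases i <;> simp
  rw [e, crossRatio_affine m ht 0]

/-- The escape radii at mesh `δ`: `r = ⌈3t/δ⌉₊`, `N = ⌊8κ/δ⌋₊` satisfy `1 ≤ r ≤ N`, `r/N ≤ 1/L` and
`δ (N + 1) < 9κ` once `0 < δ < κ`, `δ (L + 1) ≤ 5κ`, `t L = κ`, `0 < t ≤ κ`. [folklore] -/
theorem radii {t κ δ : ℝ} {L : ℕ} (ht : 0 < t) (htκ : t ≤ κ) (hδ : 0 < δ) (hδκ : δ < κ)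
    (hL : 1 ≤ L) (htL : t * L = κ) (hδL : δ * (L + 1) ≤ 5 * κ) :
    1 ≤ ⌈3 * t / δ⌉₊ ∧ ⌈3 * t / δ⌉₊ ≤ ⌊8 * κ / δ⌋₊ ∧
      ((⌈3 * t / δ⌉₊ : ℝ) / ⌊8 * κ / δ⌋₊) ≤ (L : ℝ)⁻¹ ∧ δ * ((⌊8 * κ / δ⌋₊ : ℝ) + 1) < 9 * κ := by
  have hκ : 0 < κ := lt_of_lt_of_le ht htκ
  have hL' : (1 : ℝ) ≤ L := by exact_mod_cast hL
  have hr_lo : 3 * t / δ ≤ ⌈3 * t / δ⌉₊ := Nat.le_ceil _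
  have hr_hi : (⌈3 * t / δ⌉₊ : ℝ) < 3 * t / δ + 1 := Nat.ceil_lt_add_one (by positivity)
  have hN_hi : (⌊8 * κ / δ⌋₊ : ℝ) ≤ 8 * κ / δ := Nat.floor_le (by positivity)
  have hN_lo : 8 * κ / δ < ⌊8 * κ / δ⌋₊ + 1 := Nat.lt_floor_add_one _
  have h3 : 0 < 3 * t / δ := by positivity
  -- real forms of `3t/δ`, `8κ/δ`
  have e3 : 3 * t / δ * δ = 3 * t := div_mul_cancel₀ _ hδ.ne'
  have e8 : 8 * κ / δ * δ = 8 * κ := div_mul_cancel₀ _ hδ.ne'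
  have hrN_real : (⌈3 * t / δ⌉₊ : ℝ) ≤ ⌊8 * κ / δ⌋₊ := by
    -- `3t/δ + 1 ≤ 8κ/δ - 1` since `2δ ≤ 5κ ≤ 8κ - 3t`
    have : 3 * t / δ + 2 ≤ 8 * κ / δ := by
      rw [div_add' _ _ _ hδ.ne', div_le_div_iff_of_pos_right hδ]
      nlinarith
    linarith
  refine ⟨Nat.one_le_iff_ne_zero.2 (Nat.pos_iff_ne_zero.1 (Nat.ceil_pos.2 h3)), by exact_mod_cast hrN_real,
    ?_, ?_⟩
  · -- `r / N ≤ 1/L`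
    have hNpos : (0 : ℝ) < ⌊8 * κ / δ⌋₊ := by
      have : (1 : ℝ) ≤ ⌈3 * t / δ⌉₊ := by
        exact_mod_cast Nat.one_le_iff_ne_zero.2 (Nat.pos_iff_ne_zero.1 (Nat.ceil_pos.2 h3))
      linarith
    rw [div_le_iff₀ hNpos, ← div_eq_inv_mul]
    rw [le_div_iff₀ (by positivity)]
    -- `(3t/δ + 1) L ≤ 8κ/δ - 1`, i.e. `(3t + δ) L ≤ 8κ - δ`, i.e. `3κ + δ L ≤ 8κ - δ`
    have key : (3 * t / δ + 1) * L ≤ 8 * κ / δ - 1 := by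
      have h1 : (3 * t / δ + 1) * L * δ = 3 * κ + δ * L := by
        have : (3 * t / δ + 1) * L * δ = 3 * (t * L) + δ * L := by
          field_simp
        rw [this, htL]
      have h2 : (8 * κ / δ - 1) * δ = 8 * κ - δ := by field_simp
      have h3' : 3 * κ + δ * L ≤ 8 * κ - δ := by nlinarith
      have h4 : (3 * t / δ + 1) * L * δ ≤ (8 * κ / δ - 1) * δ := by rw [h1, h2]; exact h3'
      exact (mul_le_mul_iff_of_pos_right hδ).1 h4
    nlinarith
  · -- `δ (N + 1) ≤ 8κ + δ < 9κ`
    have : δ * (⌊8 * κ / δ⌋₊ : ℝ) ≤ 8 * κ := by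
      have := mul_le_mul_of_nonneg_left hN_hi hδ.le
      rwa [mul_div_cancel₀ _ hδ.ne'] at this
    nlinarith

end SubseqRigidity

open SubseqRigidity in
/-- **Subsequential rigidity.** Under C⁺, for ANY mesh sequence `u_k → 0⁺` and any `g : ℝ → ℝ` that is
the limit along `u_k` of the crossing probabilities of every conformal rectangle (as a function of the
cross-ratio of any uniformizing datum), `g = F` on `(0,1)`. [folklore] -/
theorem eqOn_cardyFunction_of_collinearCardy_subseq
    (hC : ∀ a b c y : ℝ, a < b → b < c → c < y →
      Tendsto (fun n : ℕ ↦ μ.real (openCrossing halfPlane (arcA a b n) (rowIcc ⌊c * n⌋ ⌊y * n⌋))) atTop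
        (𝓝 (cardyFunction (crossRatio ![a, b, c, y]))))
    (u : ℕ → ℝ) (hu : Tendsto u atTop (𝓝[>] 0)) (g : ℝ → ℝ)
    (hg : ∀ (R : ConformalRectangle) (ψ : ConformalEquiv upperHalfPlaneSet R.carrier) (x : Fin 4 → ℝ),
      R.IsUniformizing ψ x →
        Tendsto (fun k ↦ bondDomainCrossingProb R (u k)) atTop (𝓝 (g (crossRatio x)))) :
    EqOn g cardyFunction (Ioo 0 1) := by
  intro x₀ hx₀
  /- Step 0: the Schwarz–Christoffel box and the boundary map `G`. -/
  obtain ⟨K, H, hK, hH, -, hbox⟩ := BoxExhaustion.exists_scBox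
  set G : ℝ → ℝ := ellipticF ((1 / 2 : ℝ) ^ 2) with hG
  have hm0 : (0 : ℝ) ≤ (1 / 2 : ℝ) ^ 2 := by positivity
  have hm1 : (1 / 2 : ℝ) ^ 2 < 1 := by norm_num
  have hGm : StrictMonoOn G (Icc (-1) 1) := strictMonoOn_ellipticF hm0 hm1
  have hG0 : G 0 = 0 := ellipticF_zero _
  have hGd : HasDerivAt G 1 0 := BoxExhaustion.hasDerivAt_ellipticF_zero
  /- Step 1: constants and the prevertex tuple. -/
  obtain ⟨C₀, α, hC₀, hα, hesc⟩ := exists_real_boxToFar_le_rpow_of_le_half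
  obtain ⟨p, hp, hp4, hpx⟩ := Rigidity.exists_tuple hx₀
  set κ : ℝ := min (min K H / 9) 1 with hκ
  have hκ0 : 0 < κ := lt_min (by positivity) one_pos
  have hκ1 : κ ≤ 1 := min_le_right _ _
  have hκKH : 9 * κ ≤ min K H := by
    have := min_le_left (min K H / 9) 1; rw [← hκ] at this; linarith
  have hκK : 9 * κ ≤ K := hκKH.trans (min_le_left _ _)
  have hκH : 9 * κ ≤ H := hκKH.trans (min_le_right _ _)
  -- the lattice marks at scale `t`
  set m : ℝ → Fin 4 → ℝ := fun t i ↦ G (t * p i) / t with hm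
  have hm_mul : ∀ t, 0 < t → ∀ i, t * m t i = G (t * p i) := fun t ht i ↦ by
    simp only [hm]; rw [mul_div_cancel₀ _ ht.ne']
  have htp : ∀ t, 0 < t → t ≤ 1 → ∀ i, t * p i ∈ Icc (-1 : ℝ) 1 := fun t ht ht1 i ↦ by
    have h1 : |t * p i| ≤ t * (1 / 4) := by
      rw [abs_mul, abs_of_pos ht]; exact mul_le_mul_of_nonneg_left (hp4 i) ht.le
    rw [abs_le] at h1
    constructor <;> linarith [h1.1, h1.2]
  have hm_mono : ∀ t, 0 < t → t ≤ 1 → StrictMono (m t) := fun t ht ht1 i j hij ↦ by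
    simp only [hm]
    refine div_lt_div_of_pos_right ?_ ht
    exact hGm (htp t ht ht1 i) (htp t ht ht1 j) (mul_lt_mul_of_pos_left (hp hij) ht)
  /- Step 2: the half-plane modulus `F(η(m(t))) → F x₀` and the mark bound `|m t i| < 2`. -/
  have hFcont : ∀ {x : ℝ}, x ∈ Ioo (0 : ℝ) 1 → ContinuousAt cardyFunction x := fun hx ↦
    continuousOn_cardyFunction_Ioo.continuousAt (Ioo_mem_nhds hx.1 hx.2)
  have hmt0 : Tendsto (fun t : ℝ ↦ (![m t 0, m t 1, m t 2, m t 3] : Fin 4 → ℝ)) (𝓝[>] 0) (𝓝 p) := by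
    have h1 := Rigidity.tendsto_marks hG0 hGd p 0 0
    simp only [add_zero] at h1
    rwa [Rigidity.vec4_eta p] at h1
  have hlim : Tendsto (fun t : ℝ ↦ cardyFunction (crossRatio ![m t 0, m t 1, m t 2, m t 3])) (𝓝[>] 0)
      (𝓝 (cardyFunction x₀)) := by
    have := RealMesh.tendsto_cardy_of_tendsto_marks hp hmt0
    rwa [hpx] at this
  have hbound : ∀ᶠ t in 𝓝[>] (0 : ℝ), ∀ i, |m t i| < 2 := by
    have h2 : ∀ᶠ t in 𝓝[>] (0 : ℝ), dist (![m t 0, m t 1, m t 2, m t 3] : Fin 4 → ℝ) p < 1 :=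
      (Metric.tendsto_nhds.1 hmt0) 1 one_pos
    filter_upwards [h2] with t ht i
    have hi : dist ((![m t 0, m t 1, m t 2, m t 3] : Fin 4 → ℝ) i) (p i) < 1 :=
      lt_of_le_of_lt (dist_le_pi_dist _ _ i) ht
    rw [Rigidity.vec4_eta (m t), Real.dist_eq] at hi
    have := hp4 i
    have h3 := abs_sub_abs_le_abs_sub (m t i) (p i)
    linarith
  /- Step 3: `|g x₀ - F x₀| ≤ ε` for every `ε > 0`. -/
  refine eq_of_forall_dist_le fun ε hε ↦ ?_
  rw [Real.dist_eq]
  -- choose `L`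
  have hevL : ∀ᶠ L : ℕ in atTop,
      (dist (cardyFunction (crossRatio ![m (κ / L) 0, m (κ / L) 1, m (κ / L) 2, m (κ / L) 3]))
          (cardyFunction x₀) < ε / 3 ∧ ∀ i, |m (κ / L) i| < 2) ∧
      (C₀ * ((L : ℝ)⁻¹) ^ α < ε / 3 ∧ 1 ≤ L) := by
    refine (Filter.Eventually.and ?_ ?_).and
      (((BoxExhaustion.tendsto_const_mul_inv_rpow C₀ hα).eventually
        (eventually_lt_nhds (show (0 : ℝ) < ε / 3 by positivity))).and (eventually_ge_atTop 1))
    · exact (Metric.tendsto_nhds.1 (hlim.comp (BoxExhaustion.tendsto_div_nat_nhdsWithin hκ0))) _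
        (by positivity)
    · exact (BoxExhaustion.tendsto_div_nat_nhdsWithin hκ0).eventually hbound
  obtain ⟨L, ⟨hL1, hbd⟩, hL3, hL⟩ := hevL.exists
  set t : ℝ := κ / L with ht
  have hLpos : (0 : ℝ) < L := by exact_mod_cast hL
  have hL1r : (1 : ℝ) ≤ L := by exact_mod_cast hL
  have ht0 : 0 < t := div_pos hκ0 hLpos
  have htκ : t ≤ κ := div_le_self hκ0.le hL1r
  have ht1 : t ≤ 1 := htκ.trans hκ1
  have htL : t * L = κ := div_mul_cancel₀ κ hLpos.ne'
  rw [Real.dist_eq] at hL1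
  /- Step 4: the box at scale `t` and its limit `g x₀` along `u_k`. -/
  have hu_mono : StrictMono (fun i ↦ t * p i) := fun i j hij ↦ mul_lt_mul_of_pos_left (hp hij) ht0
  have hu_mem : ∀ i, t * p i ∈ Ioo (-1 : ℝ) 1 := fun i ↦ by
    have h1 : |t * p i| ≤ t * (1 / 4) := by
      rw [abs_mul, abs_of_pos ht0]; exact mul_le_mul_of_nonneg_left (hp4 i) ht0.le
    rw [abs_le] at h1
    constructor <;> linarith [h1.1, h1.2]
  obtain ⟨R, hRc, hR0, hR2, φ, hφ⟩ := hbox (fun i ↦ t * p i) hu_mono hu_mem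
  have hcrt : crossRatio (fun i ↦ t * p i) = x₀ := by
    have := crossRatio_affine p ht0.ne' 0
    simp only [add_zero] at this
    rw [this, hpx]
  have hboxlim : Tendsto (fun k : ℕ ↦ bondDomainCrossingProb R (u k)) atTop (𝓝 (g x₀)) := by
    have := hg R φ _ hφ
    rwa [hcrt] at this
  have hR0' : R.arc 0 = {z : ℂ | z.im = 0 ∧ z.re ∈ Icc (t * m t 0) (t * m t 1)} := by
    rw [hR0, hm_mul t ht0 0, hm_mul t ht0 1]
  have hR2' : R.arc 2 = {z : ℂ | z.im = 0 ∧ z.re ∈ Icc (t * m t 2) (t * m t 3)} := by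
    rw [hR2, hm_mul t ht0 2, hm_mul t ht0 3]
  /- Step 5: the half-plane limit along the real meshes `u_k` (C⁺ via `RealMesh`). -/
  have hmt := hm_mono t ht0 ht1
  have hm01 := hmt (show (0 : Fin 4) < 1 by decide)
  have hm12 := hmt (show (1 : Fin 4) < 2 by decide)
  have hm23 := hmt (show (2 : Fin 4) < 3 by decide)
  have hP : Tendsto (fun k : ℕ ↦ μ.real (openCrossing halfPlane
        {v : Site 2 | v 1 = 0 ∧ t * m t 0 ≤ u k * v 0 ∧ u k * v 0 ≤ t * m t 1}
        {v : Site 2 | v 1 = 0 ∧ t * m t 2 ≤ u k * v 0 ∧ u k * v 0 ≤ t * m t 3})) atTop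
      (𝓝 (cardyFunction (crossRatio ![m t 0, m t 1, m t 2, m t 3]))) := by
    have h := (RealMesh.tendsto_realMesh hC (mul_lt_mul_of_pos_left hm01 ht0)
      (mul_lt_mul_of_pos_left hm12 ht0) (mul_lt_mul_of_pos_left hm23 ht0)).comp hu
    rwa [crossRatio_scale (m t) ht0.ne'] at h
  /- Step 6: the lattice sandwich for all large `k`. -/
  have hb : ∀ i, |t * m t i| < 2 * t := fun i ↦ by
    rw [abs_mul, abs_of_pos ht0]; nlinarith [hbd i]
  have hev_u : ∀ᶠ k in atTop, 0 < u k ∧ u k < κ ∧ u k * ((L : ℝ) + 1) ≤ 5 * κ := by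
    have h1 : ∀ᶠ δ in 𝓝[>] (0 : ℝ), 0 < δ ∧ δ < κ ∧ δ * ((L : ℝ) + 1) ≤ 5 * κ := by
      have hc : ∀ᶠ δ in 𝓝 (0 : ℝ), δ < κ ∧ δ * ((L : ℝ) + 1) ≤ 5 * κ := by
        refine (eventually_lt_nhds hκ0).and ?_
        have : Tendsto (fun δ : ℝ ↦ δ * ((L : ℝ) + 1)) (𝓝 0) (𝓝 (0 * ((L : ℝ) + 1))) :=
          tendsto_id.mul_const _
        rw [zero_mul] at this
        exact this.eventually (eventually_le_nhds (by positivity))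
      filter_upwards [self_mem_nhdsWithin, hc.filter_mono nhdsWithin_le_nhds] with δ hδ h
      exact ⟨hδ, h⟩
    exact hu.eventually h1
  have hev : ∀ᶠ k in atTop,
      bondDomainCrossingProb R (u k) ≤ μ.real (openCrossing halfPlane
          {v : Site 2 | v 1 = 0 ∧ t * m t 0 ≤ u k * v 0 ∧ u k * v 0 ≤ t * m t 1}
          {v : Site 2 | v 1 = 0 ∧ t * m t 2 ≤ u k * v 0 ∧ u k * v 0 ≤ t * m t 3}) ∧
        μ.real (openCrossing halfPlane
          {v : Site 2 | v 1 = 0 ∧ t * m t 0 ≤ u k * v 0 ∧ u k * v 0 ≤ t * m t 1}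
          {v : Site 2 | v 1 = 0 ∧ t * m t 2 ≤ u k * v 0 ∧ u k * v 0 ≤ t * m t 3}) ≤
          bondDomainCrossingProb R (u k) + C₀ * ((L : ℝ)⁻¹) ^ α := by
    filter_upwards [hev_u] with k hk
    obtain ⟨hδ, hδκ, hδL⟩ := hk
    set δ := u k with hδdef
    obtain ⟨hr1, hrN, hratio, hN9⟩ := radii ht0 htκ hδ hδκ hL htL hδL
    have hb0 := hb 0; have hb1 := hb 1; have hb2 := hb 2; have hb3 := hb 3
    rw [abs_lt] at hb0 hb1 hb2 hb3
    constructor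
    · exact stub_meshLower K H δ (t * m t 0) (t * m t 1) (t * m t 2) (t * m t 3) R hK hδ (by linarith)
        (mul_le_mul_of_nonneg_left hm01.le ht0.le) (mul_le_mul_of_nonneg_left hm23.le ht0.le)
        (by linarith) (by linarith) (by linarith) (by linarith) hRc hR0' hR2'
    · have hr : ∀ v : Site 2, v 1 = 0 → t * m t 0 ≤ δ * v 0 → δ * v 0 ≤ t * m t 1 →
          |v 0| ≤ (⌈3 * t / δ⌉₊ : ℕ) := by
        intro v _ h0 h1
        have habs : |δ * (v 0 : ℝ)| ≤ 3 * t := by rw [abs_le]; constructor <;> linarith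
        have : |(v 0 : ℝ)| ≤ 3 * t / δ := by
          rw [le_div_iff₀ hδ, mul_comm]; rwa [abs_mul, abs_of_pos hδ] at habs
        have h2 : |(v 0 : ℝ)| ≤ (⌈3 * t / δ⌉₊ : ℝ) := this.trans (Nat.le_ceil _)
        have h3 : ((|v 0| : ℤ) : ℝ) ≤ ((⌈3 * t / δ⌉₊ : ℕ) : ℤ) := by push_cast; exact h2
        exact_mod_cast h3
      have hNKH : δ * ((⌊8 * κ / δ⌋₊ : ℕ) + 1) < min K H := by linarith
      have hup := stub_meshUpper K H δ (t * m t 0) (t * m t 1) (t * m t 2) (t * m t 3) R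
        ⌈3 * t / δ⌉₊ ⌊8 * κ / δ⌋₊ hK hδ (by linarith) (by linarith) (by linarith) (by linarith)
        (by linarith) hr hrN hNKH hRc hR0' hR2'
      have hescL : μ.real {ω | ∃ x ∈ box 2 ⌈3 * t / δ⌉₊, ∃ y ∉ box 2 ⌊8 * κ / δ⌋₊,
          ω ∈ openConnIn Set.univ x y} ≤ C₀ * ((L : ℝ)⁻¹) ^ α := by
        refine (hesc half (by simp) _ _ hr1 hrN).trans ?_
        refine mul_le_mul_of_nonneg_left (Real.rpow_le_rpow (by positivity) hratio hα.le) hC₀.le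
      change μ.real _ ≤ bondDomainCrossingProb R δ + μ.real _ at hup
      linarith
  /- Step 7: pass to the limit `k → ∞` and combine. -/
  have hlow : g x₀ ≤ cardyFunction (crossRatio ![m t 0, m t 1, m t 2, m t 3]) :=
    le_of_tendsto_of_tendsto hboxlim hP (hev.mono fun k hk ↦ hk.1)
  have hhigh : cardyFunction (crossRatio ![m t 0, m t 1, m t 2, m t 3]) ≤ g x₀ + C₀ * ((L : ℝ)⁻¹) ^ α :=
    le_of_tendsto_of_tendsto hP (hboxlim.add_const _) (hev.mono fun k hk ↦ hk.2)
  rw [abs_lt] at hL1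
  rw [abs_le]
  constructor <;> linarith [hL1.1, hL1.2]

/-- **Registered stub `stub_subseqRigidity_of_collinearCardy`** (verbatim signature): C⁺ implies Cardy
rigidity along every mesh sequence — the hypothesis shape of `CardyMirrorMonotone.SubseqRigidity`
(stmt-CriticalPhenomena-8271) prefixed by C⁺. [folklore] -/
theorem stub_subseqRigidity_of_collinearCardy :
    (∀ a b c y : ℝ, a < b → b < c → c < y →
      Tendsto (fun n : ℕ ↦ μ.real (openCrossing halfPlane (arcA a b n) (rowIcc ⌊c * n⌋ ⌊y * n⌋))) atTop
        (𝓝 (Literature.Probability.RandomPlanarGeometry.cardyFunction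
          (Literature.Probability.RandomPlanarGeometry.crossRatio ![a, b, c, y])))) →
      ∀ u : ℕ → ℝ, Tendsto u atTop (nhdsWithin 0 (Set.Ioi 0)) → ∀ g : ℝ → ℝ,
        (∀ (R : Literature.Probability.RandomPlanarGeometry.ConformalRectangle)
          (ψ : Literature.Probability.RandomPlanarGeometry.ConformalEquiv UpperHalfPlane.upperHalfPlaneSet
            R.carrier) (x : Fin 4 → ℝ), R.IsUniformizing ψ x →
            Tendsto (fun k ↦ Literature.Probability.Percolation.bondDomainCrossingProb R (u k)) atTop
              (𝓝 (g (Literature.Probability.RandomPlanarGeometry.crossRatio x)))) →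
          Set.EqOn g Literature.Probability.RandomPlanarGeometry.cardyFunction (Set.Ioo 0 1) :=
  fun hC u hu g hg ↦ eqOn_cardyFunction_of_collinearCardy_subseq hC u hu g hg

end Summit.CriticalPhenomena.CardyFormulaZ2.Cruxes.HalfPlaneMarkDensityLaw.SketchLine

end
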